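import Literature.AlgebraicGeometry.Modules.PushforwardIsoUnit
import Literature.AlgebraicGeometry.Modules.PullbackFrame
import Literature.AlgebraicGeometry.Modules.LocallyFreeTrace
import HarnessLib

/-!
# Push-forward along an isomorphism of schemes: frames and the contraction `𝓗om(E, 𝓗om(E^∨, G)) → G`

Layer `Literature/AlgebraicGeometry/Modules`; continuation of `PushforwardIsoUnit.lean`. Everything PROVED;
no named facts, no new notion. For an isomorphism of schemes `ε : Y₀ ≅ Y₁`, a finite locally free `E` on
`Y₀` and any `𝒪_{Y₀}`-module `G`:

* **pushed-forward frames**: from a frame `e : 𝒪^I ≅ E|_{ε⁻¹W}` (`W ⊆ Y₁` open), the frame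
  `pushforwardFrame ε e : 𝒪^I ≅ (ε_* E)|_W` with THE SAME basis sections
  (`basisSection_pushforwardFrame`: `b_i ∈ Γ(E, ε⁻¹W) = Γ(ε_*E, W)`) and the transported dual basis
  (`dualBasis_pushforwardFrame`: `λ'_i = (λ_i pushed forward) ≫ (ε♯)⁻¹`). Construction: an abstract
  frame `θ` of `(ε_*E)|_W` exists (`(ε⁻¹)^*E ≅ ε_*E` and the tree's `nonempty_pullback_overIso`); the
  comparison `θ_j ↦ b_j` (`homOfBasisValues`) is an isomorphism with inverse `s ↦ ∑_i λ'_i(s) θ_i`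
  (basis expansion `s = ∑_i λ_i(s) b_i` in `e`);
* `frameContract_pushforwardFrame` — the frame contractions `∑_i B(b_i)(λ_i)` agree along `ε_*`;
* **`pushforward_map_contract`** — the contraction `c_G^E : 𝓗om(E, 𝓗om(E^∨, G)) → G` (the evaluation
  `E^∨ ⊗ E ⊗ G → G`, `Modules/LocallyFreeTrace.lean`) COMMUTES with `ε_*`:
  `ε_*(c_G^E) = (ε_*𝓗om(E, 𝓗om(E^∨,G)) ≅ 𝓗om(ε_*E, 𝓗om((ε_*E)^∨, ε_*G))) ≫ c_{ε_*G}^{ε_*E}`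
  (compare on the cover of `U` by the `U ∩ ε(U_y)`, `U_y` trivialising for `E`, frame by frame).

Motivation (venture HSemireg, bridge (B1), obligation (T-σ)): the trace with coefficients on `Ext`
(`HodgeTheory.traceExtCoeff`, from which the Buchweitz–Flenner components `σ_q` are built) is
`unit · 𝓗om(E, –) · contract`; this file supplies the transport of its last factor along an isomorphism
of the ambient scheme (`HodgeTheory/TraceExtPushforwardIso.lean` does the `Ext` bookkeeping).

References: R. Hartshorne, *Algebraic Geometry* (1977), II §5 (pp. 109–110: the sheaf Hom, direct images,
locally free sheaves and local bases), II Ex. 5.1 (a), (b) (`E^∨∨ ≅ E`, `𝓗om(E^∨, G) ≅ E ⊗ G`; the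
evaluation); the statements here are their bookkeeping along an isomorphism (reading; no printed
statement is typed verbatim). [Hartshorne1977]
-/

noncomputable section

-- `TopCat.Presheaf`/`Scheme.Modules` are not reducible (as in Mathlib's `AlgebraicGeometry/Modules/Sheaf.lean`).
set_option backward.isDefEq.respectTransparency false

open CategoryTheory CategoryTheory.Limits AlgebraicGeometry Opposite TopologicalSpace
open AlgebraicGeometry.Scheme.Modules

universe u

namespace Literature.AlgebraicGeometry.Modules

open Literature.AlgebraicGeometry.Motives

/-! ### Frames of `ε_* E` from frames of `E` -/

section PushforwardFrame

open scoped Classical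

variable {Y₀ Y₁ : Scheme.{u}} (ε : Y₀ ≅ Y₁) {E : Y₀.Modules} {W : Y₁.Opens} {I : Type u}

/-- If `E|_{ε⁻¹W}` is free on `I` then `(ε_* E)|_W` is (abstractly) free on `I` (through `(ε⁻¹)^*E ≅ ε_*E`
and the tree's pulled-back frames). [cite: Hartshorne1977, II §5 p. 109 (locally free sheaves: local bases; reading: a basis of E|_{ε⁻¹W} is a basis of (ε_*E)|_W)] -/
theorem nonempty_pushforward_overIso (e : SheafOfModules.free I ≅ E.over (ε.hom ⁻¹ᵁ W)) :
    Nonempty (SheafOfModules.free I ≅ ((pushforward ε.hom).obj E).over W) := by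
  have h := nonempty_pullback_overIso ε.inv e
  rw [preimage_inv_preimage_hom] at h
  obtain ⟨θ⟩ := h
  exact ⟨θ ≪≫ (SheafOfModules.overFunctor _ W).mapIso (pullbackInvIsoPushforward ε E)⟩

/-- A chosen abstract frame of `(ε_* E)|_W`. [folklore] -/
def auxPushforwardFrame (e : SheafOfModules.free I ≅ E.over (ε.hom ⁻¹ᵁ W)) : SheafOfModules.free I ≅ ((pushforward ε.hom).obj E).over W :=
  (nonempty_pushforward_overIso ε e).some

/-- The basis sections `b_i ∈ Γ(E, ε⁻¹W) = Γ(ε_* E, W)` of `e`, read as sections of `ε_* E`. [folklore] -/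
def pushedSection (e : SheafOfModules.free I ≅ E.over (ε.hom ⁻¹ᵁ W)) (i : I) : Γ((pushforward ε.hom).obj E, W) :=
  (basisSection e i : Γ(E, ε.hom ⁻¹ᵁ W))

/-- **The transported dual basis** `λ'_i = (λ_i pushed forward) ≫ (ε♯)⁻¹ : (ε_*E)|_W → 𝒪_{Y₁}|_W`. [folklore] -/
def pushedDualBasis (e : SheafOfModules.free I ≅ E.over (ε.hom ⁻¹ᵁ W)) (i : I) : ((pushforward ε.hom).obj E).over W ⟶ (unitModule Y₁).over W :=
  pushforwardOverHom ε.hom E (unitModule Y₀) (dualBasis e i) ≫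
    (SheafOfModules.overFunctor _ W).map (unitPushforwardIso ε).inv

/-- Values of the transported dual basis. [cite: Hartshorne1977, II §5 p. 109 (locally free sheaves: local bases; reading: a basis of E|_{ε⁻¹W} is a basis of (ε_*E)|_W)] -/
theorem appLE_pushedDualBasis (e : SheafOfModules.free I ≅ E.over (ε.hom ⁻¹ᵁ W)) (i : I) {V : Y₁.Opens} (k : V ⟶ W)
    (s : Γ((pushforward ε.hom).obj E, V)) :
    appLE (pushedDualBasis ε e i) k s =
      (unitPushforwardIso ε).inv.app V
        (appLE (dualBasis e i) ((Opens.map ε.hom.base).map k) (show Γ(E, ε.hom ⁻¹ᵁ V) from s) :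
          Γ(unitModule Y₀, ε.hom ⁻¹ᵁ V)) :=
  rfl

/-- `λ'_i(b_j) = δ_{ij}`. [cite: Hartshorne1977, II §5 p. 109 (locally free sheaves: local bases; reading: a basis of E|_{ε⁻¹W} is a basis of (ε_*E)|_W)] -/
theorem appLE_pushedDualBasis_pushedSection (e : SheafOfModules.free I ≅ E.over (ε.hom ⁻¹ᵁ W)) (i j : I) :
    appLE (pushedDualBasis ε e i) (𝟙 W) (pushedSection ε e j) =
      (if j = i then (1 : Y₁.ringCatSheaf.obj.obj (op W)) else 0) := by
  rw [pushedDualBasis, appLE_comp_over_map, appLE_pushforwardOverHom, pushedSection,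
    appLE_congr_hom _ ((Opens.map ε.hom.base).map (𝟙 W)) (𝟙 _), appLE_dualBasis_basisSection]
  split_ifs with h
  · change (unitPushforwardIso ε).inv.app W (1 : Γ(Y₀, ε.hom ⁻¹ᵁ W)) = (1 : Γ(Y₁, W))
    rw [← map_one (ε.hom.app W).hom]
    exact unitPushforwardIso_inv_app_app ε W 1
  · change (unitPushforwardIso ε).inv.app W (0 : Γ(Y₀, ε.hom ⁻¹ᵁ W)) = (0 : Γ(Y₁, W))
    rw [← map_zero (ε.hom.app W).hom]
    exact unitPushforwardIso_inv_app_app ε W 0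

variable [Fintype I]

/-- The comparison `θ_j ↦ b_j` from the abstract frame to the pushed sections. [folklore] -/
def pushforwardFrameComparison (e : SheafOfModules.free I ≅ E.over (ε.hom ⁻¹ᵁ W)) :
    ((pushforward ε.hom).obj E).over W ⟶ ((pushforward ε.hom).obj E).over W :=
  homOfBasisValues (auxPushforwardFrame ε e) (pushedSection ε e)

/-- Its inverse `s ↦ ∑_i λ'_i(s) θ_i`. [folklore] -/
def pushforwardFrameComparisonInv (e : SheafOfModules.free I ≅ E.over (ε.hom ⁻¹ᵁ W)) :
    ((pushforward ε.hom).obj E).over W ⟶ ((pushforward ε.hom).obj E).over W :=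
  ∑ i, pushedDualBasis ε e i ≫ smulSection (basisSection (auxPushforwardFrame ε e) i)

/-- `(θ_j ↦ b_j) ≫ (s ↦ ∑ λ'_i(s) θ_i) = 𝟙`. [cite: Hartshorne1977, II §5 p. 109 (locally free sheaves: local bases; reading: a basis of E|_{ε⁻¹W} is a basis of (ε_*E)|_W)] -/
theorem pushforwardFrameComparison_comp_inv (e : SheafOfModules.free I ≅ E.over (ε.hom ⁻¹ᵁ W)) :
    pushforwardFrameComparison ε e ≫ pushforwardFrameComparisonInv ε e = 𝟙 _ := by
  refine hom_ext_of_basisSection (auxPushforwardFrame ε e) fun j => ?_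
  rw [appLE_comp, pushforwardFrameComparison, appLE_homOfBasisValues, pushforwardFrameComparisonInv,
    appLE_sum, appLE_id]
  have h : ∀ i, appLE (pushedDualBasis ε e i ≫ smulSection (basisSection (auxPushforwardFrame ε e) i))
      (𝟙 W) (pushedSection ε e j) =
      (if j = i then (1 : Γ(Y₁, W)) else 0) • basisSection (auxPushforwardFrame ε e) i := by
    intro i
    rw [appLE_comp, appLE_smulSection, appLE_pushedDualBasis_pushedSection, presheaf_map_id]
  simp_rw [h, ite_smul, one_smul, zero_smul, Finset.sum_ite_eq, Finset.mem_univ, if_true]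

/-- `(s ↦ ∑ λ'_i(s) θ_i) ≫ (θ_j ↦ b_j) = 𝟙` (basis expansion `s = ∑ λ_i(s) b_i` in the frame `e`). [cite: Hartshorne1977, II §5 p. 109 (locally free sheaves: local bases; reading: a basis of E|_{ε⁻¹W} is a basis of (ε_*E)|_W)] -/
theorem pushforwardFrameComparisonInv_comp (e : SheafOfModules.free I ≅ E.over (ε.hom ⁻¹ᵁ W)) :
    pushforwardFrameComparisonInv ε e ≫ pushforwardFrameComparison ε e = 𝟙 _ := by
  refine hom_ext_of_appLE fun V k (s : Γ(E, ε.hom ⁻¹ᵁ V)) => ?_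
  rw [appLE_comp, appLE_id, pushforwardFrameComparisonInv, appLE_sum, appLE_sum_right]
  have h : ∀ i, appLE (pushforwardFrameComparison ε e) k
      (appLE (pushedDualBasis ε e i ≫ smulSection (basisSection (auxPushforwardFrame ε e) i)) k s) =
      coord e ((Opens.map ε.hom.base).map k) s i • E.presheaf.map ((Opens.map ε.hom.base).map k).op
        (basisSection e i) := by
    intro i
    rw [appLE_comp, appLE_smulSection, appLE_smul_right,
      appLE_congr_hom (pushforwardFrameComparison ε e) k (k ≫ 𝟙 W), appLE_map, pushforwardFrameComparison,
      appLE_homOfBasisValues, appLE_pushedDualBasis, coord_def]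
    change ε.hom.app V ((unitPushforwardIso ε).inv.app V
        (appLE (dualBasis e i) ((Opens.map ε.hom.base).map k) s : Γ(unitModule Y₀, ε.hom ⁻¹ᵁ V))) •
        E.presheaf.map ((Opens.map ε.hom.base).map k).op (basisSection e i) = _
    rw [app_unitPushforwardIso_inv_app]
  simp_rw [h]
  exact (eq_sum_coord_smul e ((Opens.map ε.hom.base).map k) s).symm

/-- **The pushed-forward frame** `𝒪^I ≅ (ε_* E)|_W` with basis sections `b_i` (the basis sections of
`e : 𝒪^I ≅ E|_{ε⁻¹W}` read in `Γ(ε_*E, W) = Γ(E, ε⁻¹W)`). [folklore] -/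
def pushforwardFrame (e : SheafOfModules.free I ≅ E.over (ε.hom ⁻¹ᵁ W)) : SheafOfModules.free I ≅ ((pushforward ε.hom).obj E).over W :=
  auxPushforwardFrame ε e ≪≫ ⟨pushforwardFrameComparison ε e, pushforwardFrameComparisonInv ε e,
    pushforwardFrameComparison_comp_inv ε e, pushforwardFrameComparisonInv_comp ε e⟩

/-- **The basis sections of the pushed-forward frame are the `b_i`.** [cite: Hartshorne1977, II §5 p. 109 (locally free sheaves: local bases; reading: a basis of E|_{ε⁻¹W} is a basis of (ε_*E)|_W)] -/
theorem basisSection_pushforwardFrame (e : SheafOfModules.free I ≅ E.over (ε.hom ⁻¹ᵁ W)) (i : I) :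
    basisSection (pushforwardFrame ε e) i = pushedSection ε e i := by
  rw [basisSection, pushforwardFrame, Iso.trans_hom, SheafOfModules.freeHomEquiv_comp_apply,
    overSectionsEquiv_sectionsMap']
  exact appLE_homOfBasisValues (auxPushforwardFrame ε e) (pushedSection ε e) i

/-- **The dual basis of the pushed-forward frame is the transported dual basis `λ'_i`.** [cite: Hartshorne1977, II §5 p. 109 (locally free sheaves: local bases; reading: a basis of E|_{ε⁻¹W} is a basis of (ε_*E)|_W)] -/
theorem dualBasis_pushforwardFrame (e : SheafOfModules.free I ≅ E.over (ε.hom ⁻¹ᵁ W)) (i : I) :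
    dualBasis (pushforwardFrame ε e) i = pushedDualBasis ε e i := by
  refine hom_ext_of_basisSection (pushforwardFrame ε e) fun j => ?_
  rw [appLE_dualBasis_basisSection, basisSection_pushforwardFrame, appLE_pushedDualBasis_pushedSection]

end PushforwardFrame

/-! ### The contraction along `ε_*` -/

section Contract

open scoped Classical

variable {Y₀ Y₁ : Scheme.{u}} (ε : Y₀ ≅ Y₁) {E : Y₀.Modules} (hE : IsFiniteLocallyFree E) (G : Y₀.Modules)

/-- Sections of `ε_*𝓗om(E^∨, G) ≅ 𝓗om((ε_*E)^∨, ε_*G)`: `β ↦ (ε_*E^∨ ≅ (ε_*E)^∨)⁻¹| ≫ (β pushed forward)`.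
[cite: Hartshorne1977, II §5 pp. 109–110 (the sheaf Hom and direct images f_*; reading: bookkeeping along an isomorphism of schemes)] -/
theorem sheafHomDualPushforwardIso_hom_app {W : Y₁.Opens}
    (β : (dual E).over (ε.hom ⁻¹ᵁ W) ⟶ G.over (ε.hom ⁻¹ᵁ W)) :
    (sheafHomDualPushforwardIso ε E G).hom.app W β =
      (SheafOfModules.overFunctor _ W).map (dualPushforwardIso ε E).inv ≫
        pushforwardOverHom ε.hom (dual E) G β := by
  change (sheafHomMapLeft (dualPushforwardIso ε E).inv _).app W (pushforwardOverHom ε.hom _ _ β) = _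
  rw [sheafHomMapLeft_app_apply]

/-- `(ε_*E^∨ ≅ (ε_*E)^∨)⁻¹` sends the transported dual basis back to `λ_i`. [cite: Hartshorne1977, II §5 p. 109 (locally free sheaves: local bases; reading: a basis of E|_{ε⁻¹W} is a basis of (ε_*E)|_W)] -/
theorem dualPushforwardIso_inv_app_pushedDualBasis {W : Y₁.Opens} {I : Type u}
    (e : SheafOfModules.free I ≅ E.over (ε.hom ⁻¹ᵁ W)) (i : I) :
    (dualPushforwardIso ε E).inv.app W (pushedDualBasis ε e i) = dualBasis e i := by
  have h : (dualPushforwardIso ε E).inv =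
      sheafHomMap _ (unitPushforwardIso ε).hom ≫ (sheafHomPushforwardIso ε E (unitModule Y₀)).inv := rfl
  rw [h, Scheme.Modules.Hom.comp_app, ConcreteCategory.comp_apply, sheafHomMap_app_apply, pushedDualBasis,
    Category.assoc, ← Functor.map_comp, Iso.inv_hom_id, CategoryTheory.Functor.map_id, Category.comp_id,
    sheafHomPushforwardIso_inv_app_apply, pullbackOverHom_pushforwardOverHom]

/-- **Frame contractions agree along `ε_*`**: for a frame `e` of `E|_{ε⁻¹W}` and
`B₀ : E|_{ε⁻¹W} → 𝓗om(E^∨, G)|_{ε⁻¹W}`, the contraction of the transported `B₀` in the pushed-forward frame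
is the contraction of `B₀` in `e` (an element of `Γ(G, ε⁻¹W) = Γ(ε_*G, W)`). [cite: Hartshorne1977, II Ex. 5.1 (b) (the evaluation E^∨ ⊗ E ⊗ G → G through 𝓗om(E, 𝓗om(E^∨, G)); reading: its bookkeeping along an isomorphism of schemes)] -/
theorem frameContract_pushforwardFrame {W : Y₁.Opens} {I : Type u} [Fintype I]
    (e : SheafOfModules.free I ≅ E.over (ε.hom ⁻¹ᵁ W))
    (B₀ : E.over (ε.hom ⁻¹ᵁ W) ⟶ (sheafHom (dual E) G).over (ε.hom ⁻¹ᵁ W)) :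
    frameContract ((pushforward ε.hom).obj G) (pushforwardFrame ε e)
        (pushforwardOverHom ε.hom _ _ B₀ ≫
          (SheafOfModules.overFunctor _ W).map (sheafHomDualPushforwardIso ε E G).hom) =
      (frameContract G e B₀ : Γ(G, ε.hom ⁻¹ᵁ W)) := by
  unfold frameContract
  refine Finset.sum_congr rfl fun i _ => ?_
  rw [dualBasis_pushforwardFrame, basisSection_pushforwardFrame, appLE_comp_over_map,
    appLE_pushforwardOverHom, sheafHomDualPushforwardIso_hom_app, appLE_over_map_comp,
    dualPushforwardIso_inv_app_pushedDualBasis, appLE_pushforwardOverHom, pushedSection,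
    appLE_congr_hom _ ((Opens.map ε.hom.base).map (𝟙 W)) (𝟙 _),
    appLE_congr_hom B₀ ((Opens.map ε.hom.base).map (𝟙 W)) (𝟙 _)]

/-- **The contraction along `ε_*`**: `ε_*(c_G^E) = (ε_*𝓗om(E, 𝓗om(E^∨,G)) ≅ 𝓗om(ε_*E, 𝓗om((ε_*E)^∨, ε_*G))) ≫ c`.
[cite: Hartshorne1977, II Ex. 5.1 (b) (the evaluation E^∨ ⊗ E ⊗ G → G; reading: its compatibility with direct images along an isomorphism)] -/
theorem pushforward_map_contract :
    (pushforward ε.hom).map (contract hE G) =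
      (sheafHomPushforwardIso ε E (sheafHom (dual E) G)).hom ≫
        sheafHomMap ((pushforward ε.hom).obj E) (sheafHomDualPushforwardIso ε E G).hom ≫
          contract (hE.pushforward_of_iso ε) ((pushforward ε.hom).obj G) := by
  refine Scheme.Modules.hom_ext _ _ fun U => AddCommGrpCat.ext
    fun (B : E.over (ε.hom ⁻¹ᵁ U) ⟶ (sheafHom (dual E) G).over (ε.hom ⁻¹ᵁ U)) => ?_
  change contractValue hE G (ε.hom ⁻¹ᵁ U) B =
    contractValue (hE.pushforward_of_iso ε) ((pushforward ε.hom).obj G) U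
      ((sheafHomMap ((pushforward ε.hom).obj E) (sheafHomDualPushforwardIso ε E G).hom).app U
        (pushforwardOverHom ε.hom _ _ B))
  rw [sheafHomMap_app_apply]
  -- compare on the cover of `U` by the `U ∩ ε(U_y)`, `U_y` the trivialising neighbourhoods of `E`
  let T : U → Y₁.Opens := fun x => U ⊓ ε.inv ⁻¹ᵁ trivNbhd hE (ε.inv.base x.1)
  have hT : ∀ x : U, ε.hom ⁻¹ᵁ T x ≤ trivNbhd hE (ε.inv.base x.1) := fun x => by
    change ε.hom ⁻¹ᵁ (U ⊓ ε.inv ⁻¹ᵁ _) ≤ _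
    rw [Scheme.Hom.preimage_inf, preimage_hom_preimage_inv]
    exact inf_le_right
  refine TopCat.Sheaf.eq_of_locally_eq' ((SheafOfModules.toSheaf _).obj ((pushforward ε.hom).obj G))
    T U (fun x => Opens.infLELeft _ _) ?_ _ _ fun x => ?_
  · intro y hy
    refine Opens.mem_iSup.2 ⟨⟨y, hy⟩, hy, ?_⟩
    change ε.inv.base y ∈ (trivNbhd hE (ε.inv.base y) : Set Y₀)
    exact mem_trivNbhd hE _
  · let ex := SheafOfModules.restrictTrivialisation (R := Y₀.ringCatSheaf) (homOfLE (hT x))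
      (trivFrame hE (ε.inv.base x.1))
    change G.presheaf.map ((Opens.map ε.hom.base).map (Opens.infLELeft _ _)).op (contractValue hE G _ B) =
      ((pushforward ε.hom).obj G).presheaf.map (Opens.infLELeft _ _).op (contractValue _ _ U _)
    rw [map_contractValue hE G ex, map_contractValue (hE.pushforward_of_iso ε) _ (pushforwardFrame ε ex),
      restrictHom_comp, restrictHom_pushforwardOverHom, restrictHom_over_map, frameContract_pushforwardFrame]

end Contract

end Literature.AlgebraicGeometry.Modules

end
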